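import Literature.MathematicalPhysics.QuantumFieldTheory.Balaban1983to89.B9Ineq347BondReadingY
import Literature.MathematicalPhysics.QuantumFieldTheory.Balaban1983to89.B9CubeLettersInvReadDict

/-!
# `Balaban1983to89.B9Ineq347BondReadingYInv` — [B9] p. 398 «the global inequalities (3.47) are consequences of the local ones (3.42) and Lemma 2.1»
# FOR THE INVARIANT-CLASS READING `kernelFamilyBInv` (sup over the gauge-invariant test class (3.39)) AT A BARE k-LEVEL INDEX WITH A SECTION OF `β`,
# AT EVERY CONFIGURATION — and the three WEIGHTED Δ_a-side members of the [B8] Thm 2 torus binder read off it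

T. Bałaban, *Propagators for lattice gauge theories in a background field*, Commun. Math. Phys. **99** (1985) 389–434
[`Balaban1985BackgroundPropagators`, "[B9]"], (3.39)–(3.42) p. 397, (3.47) p. 398 («It is easy to see that the global inequalities (3.47) are consequences of
the local ones (3.42) and Lemma 2.1»), Thm 3.3 p. 399 («the same statements hold for the operators G(U)»), (3.69) p. 404, p. 416 l. 8–9 («the expansion (3.107) is
convergent in all norms in the inequalities (3.42)–(3.47)»); T. Bałaban, *Propagators and renormalization transformations for lattice gauge theories. II*,
Commun. Math. Phys. **96** (1984) 223–250 [`Balaban1984PropagatorsII`, "[4]"], (2.52) p. 232, Lemma 2.1 (2.60)–(2.61) p. 234; T. Bałaban, *Spaces of regular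
gauge field configurations on a lattice and gauge fixing conditions*, CMP **99** (1985) 75–102 [`Balaban1985RegularSpaces`, "[B8]"], Thm 2 p. 83, (1.58)–(1.60)
pp. 86–87.

statement-level skeleton of published theorems with citation tags; proofs where landed; nothing here is a claim about the Yang–Mills mass gap

THE POINT.  dag-n06-c's `B9Ineq347BondReadingY` proves print's «(3.42) + Lemma 2.1 ⇒ (3.47)» for def-Y's PRODUCT reading `kernelFamilyB` (arguments `J ⊗ E`,
`‖E‖ ≤ 1`) at PINNED members `MemberY`.  The G-B9-LETTERS road (module M5.7, p38's `B9Thm310DeltaAIsUnitOfExpansion.eBlock_kernelFamilyBInv_GAY_of_coverCubes''`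
∕ `B9Thm310GOfLocalInverseReg335.…_of_reg335P`) delivers Thm 3.3's (3.42) block for `G(U) = Δ_a(U)⁻¹` in p21's INVARIANT-CLASS reading
`B9CubeLettersInvReadings.kernelFamilyBInv i B cfg O par` — the sup over the test class `TestY 𝔸 J = {Λ : ‖Λ(e)‖ ≤ |J(e)|}` of (3.39) — at a BARE k-level
index `i : KIdx d ℓ hd hL b₀ b₁` carrying a section `ιB` of `β`; and the [B8] Thm 2 torus assembler (sub-row G-B8-T2S, t2s-1 g9's
`B9B8KnitTorusSocketCataloguedFour` ∕ `B8Thm2TorusOfProp6DeltaAFour`) asks, besides `IsUnit Δ_a(U)`, for the three WEIGHTED bounds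
`|G_a F|₍₋₁₎ ≤ B₀|F|₍₋₃₎`, `|∇_{U,ν}G_a F|₍₋₂₎ ≤ B₀|F|₍₋₃₎`, `|Δ_U G_a F|₍₋₃₎ ≤ B₀|F|₍₋₃₎` — the (3.47) entries `n = 0, 1, 3` at `γ = −3` for EVERY `𝔸`-valued
bond function `F` (every `F` is a class member of `J := ‖F‖`).  THIS FILE is the class-reading twin of dag-n06-c's file at a bare index (§1–§4), plus the
read-out of the three weighted members from the (3.47) block (§5).

WHAT IS IN THE FILE (0 `def`, 0 new named facts, 0 sorry; standard axioms).
* §1 block pieces `Δ(y′)J := 𝟙_{ι_B(blk e) = y′}·J` (Mathlib's `Set.indicator`, no new definition): `sum_piece`, `suppIn_piece`, `len_blkB_eqK`, `supNorm_piece_le`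
  (`geo9K_len_pos` REUSED from `B9GeoLemma21KLevelV1`);
  class members cut to a block are class members of the cut profile (`piece_mem_testY`).
* §2 the four inner (3.42) readings (written out) are sub-additive along finite sums (`eIn_sum_le`), nonnegative, bounded uniformly over the class
  (`exists_testY_bound_lin`, `exists_testY_bound_eIn`); `kernelFamilyBInv_e_inr` (`rfl`); ★ `e_subadd_kernelFamilyBInv`.
* §3 ★ `glob_le_kernelFamilyBInv` («the smallest number C such that …», p21's `wNormBY_le_of_pointwise`).
* §4 ★★ `globReading_kernelFamilyBInv` — the reading axioms `B9Ineq347Reading.GlobReading` for `kernelFamilyBInv` on the bond arguments; ★★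
  `globBlockOn_kernelFamilyBInv_of_eBlock` — `EBlock (kernelFamilyBInv …) B₀ δ₀ c → GlobBlockOn (kernelFamilyBInv …) (bond args) (B₀·c₁(d′,δ₀,1−α)·L⁴) c`
  given [4] (2.60) at `α`, (2.61) at `1 − α` for `toB6 (geo9K i) Rr Hp` and the size condition `4·log L ≤ α·δ₀·Rr·(L·M_h)` (DISPLAYED, as in p38's endpoints).
* §5 `wNormB_norm_eq_wNormBY`, `exists_testY_bound_wNormBY`, ★★★ `wNormBY_three_of_globBlockOn` — from `GlobBlockOn (kernelFamilyBInv i B cfg O par) (bond args) B₀ c`: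
  `∀ F, |O(U)F|₍₋₁₎ ≤ B₀|F|₍₋₃₎`, `∀ F ν, |∇_{U,ν}O(U)F|₍₋₂₎ ≤ B₀|F|₍₋₃₎`, `∀ F, |Δ_U O(U)F|₍₋₃₎ ≤ B₀|F|₍₋₃₎` (`U := cfg c`) — VERBATIM the weighted members
  (2)–(4) of the torus binder at `O := GAY i (parKnitY i) (parBY i) (GpY i (parKnitY i))`; ★★★ `wNormBY_three_of_eBlock` — the same straight from the
  (3.42) block and Lemma 2.1's inequalities.

HONEST SCOPE.  Print's «easy to see» bookkeeping for one concrete reading; the analytic inputs — the (3.42) block of the operator and [4] Lemma 2.1's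
(2.60)∕(2.61) with the size condition — are HYPOTHESES here (the former is Thm 3.3 ∕ 3.10's content, the G-B9-LETTERS road; the latter is in the tree per
member above thresholds, e.g. `B9RWSums347DefiniteFacesWindow.lemma21Window_geo9Y`, and is displayed in p38's M5.7 endpoints in exactly this form).  Nothing
of Theorem 3.3 is asserted; per index, under the section hypothesis `hι`.  COUNT-NEUTRAL; no node ∕ summit statement discharged; `stub_PV3A` NOT discharged;
one finite lattice programme — nothing continuum ∕ ℝ⁴ ∕ OS ∕ mass-gap ∕ Clay: the Yang–Mills mass gap is NOT proved by any of this.  No `sorry`, no `axiom`,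
no `def`, no `instance`, no `notation`.  NEW file; nothing landed is modified.  Cell `lit-balaban`, seat `lit-balaban-t2s-1` gen 9, 2026-08-28;
`--supports stmt-QuantumFields-19200`.

RELATED IN THE TREE, NOT DUPLICATED: `B9Ineq347BondReadingY` (product reading, pinned members — TEMPLATE, followed line by line; its `MemberY`-indexed pieces
cannot be instantiated at a bare `KIdx`), `B9Ineq347Reading` (`GlobReading`, `globBlockOn_of_eBlock` — USED), `B9CubeLettersInvReadDict` (`le_iSup_testY`,
`iSup_testY_le` — USED), `B9CubeLettersInvReadDictB` (`supInB` API — USED), `B9Ineq347GAAtLetters` (`wNormBY_le_of_pointwise` — USED).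
-/

noncomputable section

namespace Literature.MathematicalPhysics.QuantumFieldTheory.Balaban1983to89.B9Ineq347BondReadingYInv

open B6KLevelCensusIndexV1 (KIdx kGeo)
open B6Ineq2142KLevelV1 (β lvl beta_level)
open B6GlobalChartV1 (blkV1)
open B6RandomWalk (Ineq260 Ineq261)
open B9Thm34Ext (toB6)
open B9FromB6 (EBlock)
open B9ResidualEntriesAtOne (GlobBlockOn)
open B9Ineq347Reading (GlobReading globBlockOn_of_eBlock)
open B9CubeLettersInvReadings (TestY kernelFamilyBInv)
open B9CubeLettersInvReadDict (le_iSup_testY iSup_testY_le)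
open B9CubeLettersInvReadDictB (norm_le_supInB supInB_le supInB_nonneg le_iSup_fin)
open B9CoReadingCoords (cdBₗ cdsBₗ lapBₗ cdBₗ_apply cdsBₗ_apply lapBₗ_apply)
open B9Ineq347GAAtLetters (wNormBY_le_of_pointwise)
open B9GeoLemma21KLevelV1 (geo9K_eta_pos geo9K_one_le_L geo9K_len_pos)
open B9GeoNormsKLevelV1 (geo9K wNormB wNormB_nonneg abs_le_of_wNormB_le geo9K_wNorm_nonneg)
open B8ScaledSupNorm (msup weight)
open Node00 (SiteY BlkY FBondY IBondY CfgY KLoc BondOpY BondParY supInB cdB cdsB lapB wNormBY)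

variable {𝔸 : Type} [NormedRing 𝔸] [NormedAlgebra ℂ 𝔸] [CompleteSpace 𝔸] [FiniteDimensional ℝ 𝔸]
variable {d ℓ : ℕ} {hd : 1 ≤ d + 1} {hL : Odd (ℓ + 1) ∧ 1 < ℓ + 1} {b₀ b₁ : ℝ}

/-! ## §1 Block pieces of a bond argument and of a class member (Mathlib's `Set.indicator`) -/

section Pieces

variable (i : KIdx d ℓ hd hL b₀ b₁) (ιB : BlkY i → IBondY i)

omit [NormedRing 𝔸] [NormedAlgebra ℂ 𝔸] [CompleteSpace 𝔸] [FiniteDimensional ℝ 𝔸] in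
/-- **J = Σ_{y′} Δ(y′)J** over the labels (each fine bond lies in exactly one labelled block), for functions with values in any additive commutative monoid
(real profiles and `𝔸`-valued class members alike). [cite: Balaban1984PropagatorsII, (2.52) p.232] -/
theorem sum_piece [inst : Fintype (geo9K i).Site] {M : Type} [AddCommMonoid M] (F : FBondY i → M) :
    ∑ b : (geo9K i).Site, Set.indicator {e : FBondY i | ιB (blkV1 i.hN i.D e) = b} F = F := by
  classical
  funext e
  rw [Finset.sum_apply]
  refine (Finset.sum_eq_single (ιB (blkV1 i.hN i.D e) : (geo9K i).Site) (fun b _ hb => ?_)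
    (fun h => absurd (@Finset.mem_univ _ inst _) h)).trans
    (Set.indicator_of_mem (show e ∈ {e' : FBondY i | ιB (blkV1 i.hN i.D e') = ιB (blkV1 i.hN i.D e)} from rfl) F)
  exact Set.indicator_of_notMem (show e ∉ {e' : FBondY i | ιB (blkV1 i.hN i.D e') = b} from fun h => hb h.symm) F

omit [FiniteDimensional ℝ 𝔸] in
/-- **supp Δ(y′)J ⊂ Δ(y′)** in the reading's sense (the labelling is a section of `β`). [cite: Balaban1985BackgroundPropagators, (3.42) p.397 («supp λ ⊂ Δ(y′)»)] -/
theorem suppIn_piece [Fintype (geo9K i).Site] (hι : ∀ s : BlkY i, β i.hN i.D i.hk (ιB s) = s) (b : IBondY i) (J : FBondY i → ℝ) :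
    (geo9K i).suppIn (.inr (Set.indicator {e : FBondY i | ιB (blkV1 i.hN i.D e) = b} J)) b := by
  show ∀ e : FBondY i, Set.indicator {e : FBondY i | ιB (blkV1 i.hN i.D e) = b} J e ≠ 0 → blkV1 i.hN i.D e = β i.hN i.D i.hk b
  intro e he
  by_cases h : ιB (blkV1 i.hN i.D e) = b
  · rw [← h, hι]
  · exact absurd (Set.indicator_of_notMem (show e ∉ {e : FBondY i | ιB (blkV1 i.hN i.D e) = b} from h) J) he

omit [NormedRing 𝔸] [NormedAlgebra ℂ 𝔸] [CompleteSpace 𝔸] [FiniteDimensional ℝ 𝔸] in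
/-- the length of the labelled block of a fine bond is the printed scale `L^{j(e)}η`. [cite: Balaban1985BackgroundPropagators, (3.41) p.397 («Lʲη»), dictionary] -/
theorem len_blkB_eqK (hι : ∀ s : BlkY i, β i.hN i.D i.hk (ιB s) = s) (e : FBondY i) :
    (geo9K i).len (ιB (blkV1 i.hN i.D e)) = ((ℓ : ℝ) + 1) ^ ((blkV1 i.hN i.D e).1.1) * |i.cf|⁻¹ := by
  have hk1 : 1 ≤ i.k := le_trans one_le_two i.hk2
  show (kGeo i).L ^ lvl i.hN i.D i.hk (ιB (blkV1 i.hN i.D e)) * (kGeo i).eta = _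
  rw [← beta_level i.hN i.D i.hk hk1, hι]
  push_cast
  rfl

omit [FiniteDimensional ℝ 𝔸] in
/-- **|Δ(y′)J| ≦ (L^{j′}η)^γ·|J|_{(γ)}** (the sentence after (3.41)). [cite: Balaban1985BackgroundPropagators, (3.41) p.397] -/
theorem supNorm_piece_le [Fintype (geo9K i).Site] (hι : ∀ s : BlkY i, β i.hN i.D i.hk (ιB s) = s) (b : IBondY i) (J : FBondY i → ℝ) (γ : ℝ) :
    (geo9K i).supNorm (.inr (Set.indicator {e : FBondY i | ιB (blkV1 i.hN i.D e) = b} J)) ≤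
      (geo9K i).len b ^ γ * (geo9K i).wNorm γ (.inr J) := by
  show (⨆ e : FBondY i, |Set.indicator {e : FBondY i | ιB (blkV1 i.hN i.D e) = b} J e|) ≤ (geo9K i).len b ^ γ * wNormB i γ J
  have hw : 0 ≤ wNormB i γ J := wNormB_nonneg i γ J
  have hlen : 0 ≤ (geo9K i).len b := (geo9K_len_pos i b).le
  refine Real.iSup_le (fun e => ?_) (mul_nonneg (Real.rpow_nonneg hlen γ) hw)
  by_cases he : ιB (blkV1 i.hN i.D e) = b
  · rw [Set.indicator_of_mem (show e ∈ {e : FBondY i | ιB (blkV1 i.hN i.D e) = b} from he)]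
    have h := abs_le_of_wNormB_le i (le_refl (wNormB i γ J)) e
    rw [← he, len_blkB_eqK i ιB hι e, mul_comm]
    push_cast at h
    exact h
  · rw [Set.indicator_of_notMem (show e ∉ {e : FBondY i | ιB (blkV1 i.hN i.D e) = b} from he), abs_zero]
    exact mul_nonneg (Real.rpow_nonneg hlen γ) hw

omit [NormedAlgebra ℂ 𝔸] [CompleteSpace 𝔸] [FiniteDimensional ℝ 𝔸] in
/-- **a class member cut to a block is a class member of the cut profile**: `‖𝟙_Δ Λ(e)‖ ≤ |𝟙_Δ J(e)|`. [cite: Balaban1985BackgroundPropagators, (3.39) p.397, (3.42) p.397, bookkeeping] -/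
theorem piece_mem_testY (S : Set (FBondY i)) {J : FBondY i → ℝ} (Λ : TestY 𝔸 J) (e : FBondY i) :
    ‖Set.indicator S Λ.1 e‖ ≤ |Set.indicator S J e| := by
  by_cases h : e ∈ S
  · rw [Set.indicator_of_mem h, Set.indicator_of_mem h]; exact Λ.2 e
  · rw [Set.indicator_of_notMem h, Set.indicator_of_notMem h, norm_zero, abs_zero]

end Pieces

/-! ## §2 The inner (3.42) readings of the class reading: sub-additivity, bounds over the class, `e_subadd` -/

section Subadd

variable (i : KIdx d ℓ hd hL b₀ b₁)

omit [NormedAlgebra ℂ 𝔸] [CompleteSpace 𝔸] [FiniteDimensional ℝ 𝔸] in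
/-- the block sup is sub-additive along finite sums. [cite: Balaban1985BackgroundPropagators, (3.42) p.397; Balaban1984PropagatorsII, (2.52) p.232] -/
theorem supInB_sum_le {β' : Type} (S : Finset β') (s : BlkY i) (Ψ : β' → FBondY i → 𝔸) :
    supInB i s (∑ b ∈ S, Ψ b) ≤ ∑ b ∈ S, supInB i s (Ψ b) := by
  refine supInB_le i s _ (Finset.sum_nonneg fun b _ => supInB_nonneg i s (Ψ b)) fun e he => ?_
  rw [Finset.sum_apply]
  exact (norm_sum_le _ _).trans (Finset.sum_le_sum fun b _ => norm_le_supInB i s (Ψ b) he)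

omit [NormedAlgebra ℂ 𝔸] [CompleteSpace 𝔸] [FiniteDimensional ℝ 𝔸] in
/-- a directional sup of block sups is sub-additive along finite sums. [cite: Balaban1985BackgroundPropagators, (3.42) p.397; Balaban1984PropagatorsII, (2.52) p.232] -/
theorem iSup_supInB_sum_le {β' : Type} (S : Finset β') (s : BlkY i) (Ψ : β' → Fin (d + 1) → FBondY i → 𝔸) :
    (⨆ ν : Fin (d + 1), supInB i s (∑ b ∈ S, Ψ b ν)) ≤ ∑ b ∈ S, ⨆ ν : Fin (d + 1), supInB i s (Ψ b ν) := by
  refine Real.iSup_le (fun ν => ?_) (Finset.sum_nonneg fun b _ => Real.iSup_nonneg fun ν => supInB_nonneg i s _)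
  refine (supInB_sum_le i S s (fun b => Ψ b ν)).trans (Finset.sum_le_sum fun b _ => ?_)
  exact le_iSup_fin (fun ν' => supInB i s (Ψ b ν')) ν

omit [FiniteDimensional ℝ 𝔸] in
/-- **THE FOUR INNER (3.42) READINGS `[sup_Δ‖OΛ‖, sup_ν sup_Δ‖∇_νOΛ‖, sup_ν sup_Δ‖O∇*_νΛ‖, sup_Δ‖Δ_UOΛ‖]_n` ARE SUB-ADDITIVE ALONG FINITE SUMS OF ARGUMENTS**
(linearity of `O(U)`, `∇_U`, `∇*_U`, `Δ_U` and of the block sups). [cite: Balaban1985BackgroundPropagators, (3.42) p.397; Balaban1984PropagatorsII, (2.52) p.232] -/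
theorem eIn_sum_le {β' : Type} (S : Finset β') (O : BondOpY 𝔸 i) (U : CfgY 𝔸 i) (Λ : β' → FBondY i → 𝔸) (s : BlkY i) (n : Fin 4) :
    (![supInB i s (O U (∑ b ∈ S, Λ b)), ⨆ ν : Fin (d + 1), supInB i s (cdB i U ν (O U (∑ b ∈ S, Λ b))),
        ⨆ ν : Fin (d + 1), supInB i s (O U (cdsB i U ν (∑ b ∈ S, Λ b))), supInB i s (lapB i U (O U (∑ b ∈ S, Λ b)))] : Fin 4 → ℝ) n ≤
      ∑ b ∈ S, (![supInB i s (O U (Λ b)), ⨆ ν : Fin (d + 1), supInB i s (cdB i U ν (O U (Λ b))),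
        ⨆ ν : Fin (d + 1), supInB i s (O U (cdsB i U ν (Λ b))), supInB i s (lapB i U (O U (Λ b)))] : Fin 4 → ℝ) n := by
  have hO : O U (∑ b ∈ S, Λ b) = ∑ b ∈ S, O U (Λ b) := map_sum _ _ _
  match n with
  | 0 =>
    show supInB i s (O U (∑ b ∈ S, Λ b)) ≤ ∑ b ∈ S, supInB i s (O U (Λ b))
    rw [hO]
    exact supInB_sum_le i S s _
  | 1 =>
    show (⨆ ν : Fin (d + 1), supInB i s (cdB i U ν (O U (∑ b ∈ S, Λ b)))) ≤ ∑ b ∈ S, ⨆ ν : Fin (d + 1), supInB i s (cdB i U ν (O U (Λ b)))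
    have h : ∀ ν, cdB i U ν (O U (∑ b ∈ S, Λ b)) = ∑ b ∈ S, cdB i U ν (O U (Λ b)) := fun ν => by
      rw [hO, ← cdBₗ_apply, map_sum]
      simp only [cdBₗ_apply]
    simp only [h]
    exact iSup_supInB_sum_le i S s (fun b ν => cdB i U ν (O U (Λ b)))
  | 2 =>
    show (⨆ ν : Fin (d + 1), supInB i s (O U (cdsB i U ν (∑ b ∈ S, Λ b)))) ≤ ∑ b ∈ S, ⨆ ν : Fin (d + 1), supInB i s (O U (cdsB i U ν (Λ b)))
    have h : ∀ ν, O U (cdsB i U ν (∑ b ∈ S, Λ b)) = ∑ b ∈ S, O U (cdsB i U ν (Λ b)) := fun ν => by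
      rw [← cdsBₗ_apply, map_sum, map_sum]
      simp only [cdsBₗ_apply]
    simp only [h]
    exact iSup_supInB_sum_le i S s (fun b ν => O U (cdsB i U ν (Λ b)))
  | 3 =>
    show supInB i s (lapB i U (O U (∑ b ∈ S, Λ b))) ≤ ∑ b ∈ S, supInB i s (lapB i U (O U (Λ b)))
    have h : lapB i U (O U (∑ b ∈ S, Λ b)) = ∑ b ∈ S, lapB i U (O U (Λ b)) := by
      rw [hO, ← lapBₗ_apply, map_sum]
      simp only [lapBₗ_apply]
    rw [h]
    exact supInB_sum_le i S s _

omit [FiniteDimensional ℝ 𝔸] in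
/-- the four inner readings are nonnegative. [cite: Balaban1985BackgroundPropagators, (3.42) p.397, bookkeeping] -/
theorem eIn_nonneg (O : BondOpY 𝔸 i) (U : CfgY 𝔸 i) (Λ : FBondY i → 𝔸) (s : BlkY i) (n : Fin 4) :
    0 ≤ (![supInB i s (O U Λ), ⨆ ν : Fin (d + 1), supInB i s (cdB i U ν (O U Λ)),
        ⨆ ν : Fin (d + 1), supInB i s (O U (cdsB i U ν Λ)), supInB i s (lapB i U (O U Λ))] : Fin 4 → ℝ) n := by
  match n with
  | 0 => exact supInB_nonneg i s (O U Λ)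
  | 1 => exact Real.iSup_nonneg fun ν => supInB_nonneg i s _
  | 2 => exact Real.iSup_nonneg fun ν => supInB_nonneg i s _
  | 3 => exact supInB_nonneg i s (lapB i U (O U Λ))

omit [CompleteSpace 𝔸] in
/-- a uniform bound over the class for an ℝ-linear image (finite dimension): `‖(TΛ)(e)‖ ≤ ‖T‖·‖J‖`. [cite: Balaban1985BackgroundPropagators, (3.39) p.397, (3.42) p.397, bookkeeping] -/
theorem exists_testY_bound_lin (T : (FBondY i → 𝔸) →ₗ[ℝ] (FBondY i → 𝔸)) (J : FBondY i → ℝ) :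
    ∃ C : ℝ, 0 ≤ C ∧ ∀ (Λ : TestY 𝔸 J) (e : FBondY i), ‖T Λ.1 e‖ ≤ C := by
  refine ⟨‖LinearMap.toContinuousLinearMap T‖ * ‖J‖, mul_nonneg (ContinuousLinearMap.opNorm_nonneg _) (norm_nonneg _), fun Λ e => ?_⟩
  have hΛ : ‖Λ.1‖ ≤ ‖J‖ := by
    refine (pi_norm_le_iff_of_nonneg (norm_nonneg J)).2 fun w => (Λ.2 w).trans ?_
    rw [← Real.norm_eq_abs]
    exact norm_le_pi_norm J w
  calc ‖T Λ.1 e‖ ≤ ‖T Λ.1‖ := norm_le_pi_norm _ e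
    _ = ‖LinearMap.toContinuousLinearMap T Λ.1‖ := rfl
    _ ≤ ‖LinearMap.toContinuousLinearMap T‖ * ‖Λ.1‖ := ContinuousLinearMap.le_opNorm _ _
    _ ≤ ‖LinearMap.toContinuousLinearMap T‖ * ‖J‖ := mul_le_mul_of_nonneg_left hΛ (ContinuousLinearMap.opNorm_nonneg _)

/-- the four inner readings of `O(U)Λ` are bounded uniformly over the class of `J`. [cite: Balaban1985BackgroundPropagators, (3.39) p.397, (3.42) p.397, bookkeeping] -/
theorem exists_testY_bound_eIn (O : BondOpY 𝔸 i) (U : CfgY 𝔸 i) (J : FBondY i → ℝ) (s : BlkY i) (n : Fin 4) :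
    ∃ C : ℝ, ∀ Λ : TestY 𝔸 J,
      (![supInB i s (O U Λ.1), ⨆ ν : Fin (d + 1), supInB i s (cdB i U ν (O U Λ.1)),
        ⨆ ν : Fin (d + 1), supInB i s (O U (cdsB i U ν Λ.1)), supInB i s (lapB i U (O U Λ.1))] : Fin 4 → ℝ) n ≤ C := by
  obtain ⟨C₀, hC₀, h₀⟩ := exists_testY_bound_lin i ((O U).restrictScalars ℝ) J
  have hL : ∀ ν, ∃ C, 0 ≤ C ∧ ∀ (Λ : TestY 𝔸 J) e, ‖cdB i U ν (O U Λ.1) e‖ ≤ C := fun ν => by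
    obtain ⟨C, hC, h⟩ := exists_testY_bound_lin i (cdBₗ i U ν ∘ₗ (O U).restrictScalars ℝ) J
    exact ⟨C, hC, fun Λ e => by simpa [cdBₗ_apply] using h Λ e⟩
  have hRs : ∀ ν, ∃ C, 0 ≤ C ∧ ∀ (Λ : TestY 𝔸 J) e, ‖O U (cdsB i U ν Λ.1) e‖ ≤ C := fun ν => by
    obtain ⟨C, hC, h⟩ := exists_testY_bound_lin i ((O U).restrictScalars ℝ ∘ₗ cdsBₗ i U ν) J
    exact ⟨C, hC, fun Λ e => by simpa [cdsBₗ_apply] using h Λ e⟩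
  have hΔ : ∃ C, 0 ≤ C ∧ ∀ (Λ : TestY 𝔸 J) e, ‖lapB i U (O U Λ.1) e‖ ≤ C := by
    obtain ⟨C, hC, h⟩ := exists_testY_bound_lin i (lapBₗ i U ∘ₗ (O U).restrictScalars ℝ) J
    exact ⟨C, hC, fun Λ e => by simpa [lapBₗ_apply] using h Λ e⟩
  choose CL hCL0 hCL using hL
  choose CRs hCRs0 hCRs using hRs
  obtain ⟨CΔ, hCΔ0, hCΔ⟩ := hΔ
  have hsumL : ∀ ν, CL ν ≤ ∑ μ, CL μ := fun ν => Finset.single_le_sum (fun μ _ => hCL0 μ) (Finset.mem_univ ν)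
  have hsumRs : ∀ ν, CRs ν ≤ ∑ μ, CRs μ := fun ν => Finset.single_le_sum (fun μ _ => hCRs0 μ) (Finset.mem_univ ν)
  match n with
  | 0 => exact ⟨C₀, fun Λ => supInB_le i s _ hC₀ fun e _ => h₀ Λ e⟩
  | 1 =>
    refine ⟨∑ μ, CL μ, fun Λ => Real.iSup_le (fun ν => ?_) (Finset.sum_nonneg fun μ _ => hCL0 μ)⟩
    exact supInB_le i s _ (Finset.sum_nonneg fun μ _ => hCL0 μ) fun e _ => (hCL ν Λ e).trans (hsumL ν)
  | 2 =>
    refine ⟨∑ μ, CRs μ, fun Λ => Real.iSup_le (fun ν => ?_) (Finset.sum_nonneg fun μ _ => hCRs0 μ)⟩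
    exact supInB_le i s _ (Finset.sum_nonneg fun μ _ => hCRs0 μ) fun e _ => (hCRs ν Λ e).trans (hsumRs ν)
  | 3 => exact ⟨CΔ, fun Λ => supInB_le i s _ hCΔ0 fun e _ => hCΔ Λ e⟩

omit [FiniteDimensional ℝ 𝔸] in
/-- the (3.42) reading of `kernelFamilyBInv` on a bond argument IS the sup over the class of the inner readings (`rfl`). [cite: Balaban1985BackgroundPropagators, Thm 3.3 p.399, (3.39) p.397, bookkeeping] -/
theorem kernelFamilyBInv_e_inr (B : B9.Backgrounds) (cfg : B.Cfg → CfgY 𝔸 i) (O : BondOpY 𝔸 i) (par : BondParY 𝔸 i) (n : Fin 4) (c : B.Cfg)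
    (J : FBondY i → ℝ) (y : IBondY i) :
    (kernelFamilyBInv i B cfg O par).e n c (.inr J) y =
      ⨆ Λ : TestY 𝔸 J, (![supInB i (β i.hN i.D i.hk y) (O (cfg c) Λ.1),
        ⨆ ν : Fin (d + 1), supInB i (β i.hN i.D i.hk y) (cdB i (cfg c) ν (O (cfg c) Λ.1)),
        ⨆ ν : Fin (d + 1), supInB i (β i.hN i.D i.hk y) (O (cfg c) (cdsB i (cfg c) ν Λ.1)),
        supInB i (β i.hN i.D i.hk y) (lapB i (cfg c) (O (cfg c) Λ.1))] : Fin 4 → ℝ) n := by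
  match n with
  | 0 => rfl
  | 1 => rfl
  | 2 => rfl
  | 3 => rfl

variable (ιB : BlkY i → IBondY i)

/-- ★ **SUB-ADDITIVITY OF THE (3.42) READINGS OF `kernelFamilyBInv` ALONG J = Σ_{y′} Δ(y′)J** (the `e_subadd` axiom of `GlobReading`): a class member `Λ` of `J`
is the sum of its block pieces, each a class member of the corresponding piece of `J`. [cite: Balaban1985BackgroundPropagators, (3.39) p.397, (3.42) p.397, Thm 3.3 p.399; Balaban1984PropagatorsII, (2.52) p.232] -/
theorem e_subadd_kernelFamilyBInv [Fintype (geo9K i).Site] (B : B9.Backgrounds) (cfg : B.Cfg → CfgY 𝔸 i) (O : BondOpY 𝔸 i) (par : BondParY 𝔸 i)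
    (c : B.Cfg) (n : Fin 4) (J : FBondY i → ℝ) (y : IBondY i) :
    (kernelFamilyBInv i B cfg O par).e n c (.inr J) y ≤
      ∑ b : (geo9K i).Site, (kernelFamilyBInv i B cfg O par).e n c
        (.inr (Set.indicator {e : FBondY i | ιB (blkV1 i.hN i.D e) = b} J)) y := by
  simp only [kernelFamilyBInv_e_inr]
  set s := β i.hN i.D i.hk y
  set U := cfg c
  -- the pieces of a class member
  let pc : ∀ b : (geo9K i).Site, TestY 𝔸 J → TestY 𝔸 (Set.indicator {e : FBondY i | ιB (blkV1 i.hN i.D e) = b} J) :=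
    fun b Λ => ⟨Set.indicator {e : FBondY i | ιB (blkV1 i.hN i.D e) = b} Λ.1, piece_mem_testY i _ Λ⟩
  have hbd : ∀ b : (geo9K i).Site, ∃ C : ℝ, ∀ Λ' : TestY 𝔸 (Set.indicator {e : FBondY i | ιB (blkV1 i.hN i.D e) = b} J),
      (![supInB i s (O U Λ'.1), ⨆ ν : Fin (d + 1), supInB i s (cdB i U ν (O U Λ'.1)),
        ⨆ ν : Fin (d + 1), supInB i s (O U (cdsB i U ν Λ'.1)), supInB i s (lapB i U (O U Λ'.1))] : Fin 4 → ℝ) n ≤ C :=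
    fun b => exists_testY_bound_eIn i O U _ s n
  have hsum_nonneg : 0 ≤ ∑ b : (geo9K i).Site, ⨆ Λ' : TestY 𝔸 (Set.indicator {e : FBondY i | ιB (blkV1 i.hN i.D e) = b} J),
      (![supInB i s (O U Λ'.1), ⨆ ν : Fin (d + 1), supInB i s (cdB i U ν (O U Λ'.1)),
        ⨆ ν : Fin (d + 1), supInB i s (O U (cdsB i U ν Λ'.1)), supInB i s (lapB i U (O U Λ'.1))] : Fin 4 → ℝ) n :=
    Finset.sum_nonneg fun b _ => Real.iSup_nonneg fun Λ' => eIn_nonneg i O U _ s n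
  refine iSup_testY_le (fun Λ => ?_) hsum_nonneg
  have hdec : Λ.1 = ∑ b : (geo9K i).Site, (pc b Λ).1 := (sum_piece i ιB Λ.1).symm
  rw [hdec]
  refine (eIn_sum_le i Finset.univ O U (fun b => (pc b Λ).1) s n).trans (Finset.sum_le_sum fun b _ => ?_)
  exact le_iSup_testY (hbd b).choose_spec (pc b Λ)

end Subadd

/-! ## §3 «The smallest number C such that …»: the (3.47) readings from block bounds -/

section GlobLe

variable (i : KIdx d ℓ hd hL b₀ b₁) (ιB : BlkY i → IBondY i)

/-- ★ **THE `glob_le` AXIOM FOR `kernelFamilyBInv`**: if every (3.42) block reading of the class of `J` at the labelled blocks satisfies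
`e_n ≦ C·[(Lʲη)², Lʲη, Lʲη, 1]_n·(Lʲη)^γ`, then the n-th (3.47) reading is `≦ C` — member by member of the class (p21's `wNormBY_le_of_pointwise`).
[cite: Balaban1985BackgroundPropagators, (3.41) p.397 («the smallest number C»), (3.39) p.397, (3.47) p.398, Thm 3.3 p.399] -/
theorem glob_le_kernelFamilyBInv [Fintype (geo9K i).Site] (hι : ∀ s : BlkY i, β i.hN i.D i.hk (ιB s) = s)
    (B : B9.Backgrounds) (cfg : B.Cfg → CfgY 𝔸 i) (O : BondOpY 𝔸 i) (par : BondParY 𝔸 i) (c : B.Cfg) (n : Fin 4)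
    (J : FBondY i → ℝ) (γ C : ℝ) (hC : 0 ≤ C)
    (h : ∀ y : IBondY i, (kernelFamilyBInv i B cfg O par).e n c (.inr J) y ≤
      C * B9.pref4 ((geo9K i).len y) n * (geo9K i).len y ^ γ) :
    (kernelFamilyBInv i B cfg O par).glob n c (.inr J) γ ≤ C := by
  -- the inner reading at the labelled block of the fine bond `e`, below the sup over the class, below the hypothesis
  have hKe : ∀ (e : FBondY i) (Λ : TestY 𝔸 J),
      (![supInB i (blkV1 i.hN i.D e) (O (cfg c) Λ.1), ⨆ ν : Fin (d + 1), supInB i (blkV1 i.hN i.D e) (cdB i (cfg c) ν (O (cfg c) Λ.1)),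
        ⨆ ν : Fin (d + 1), supInB i (blkV1 i.hN i.D e) (O (cfg c) (cdsB i (cfg c) ν Λ.1)),
        supInB i (blkV1 i.hN i.D e) (lapB i (cfg c) (O (cfg c) Λ.1))] : Fin 4 → ℝ) n ≤
        C * B9.pref4 ((geo9K i).len (ιB (blkV1 i.hN i.D e))) n * (geo9K i).len (ιB (blkV1 i.hN i.D e)) ^ γ := by
    intro e Λ
    have h1 := h (ιB (blkV1 i.hN i.D e))
    rw [kernelFamilyBInv_e_inr, hι] at h1
    refine le_trans ?_ h1
    exact le_iSup_testY (exists_testY_bound_eIn i O (cfg c) J (blkV1 i.hN i.D e) n).choose_spec Λ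
  -- the printed scale at `e`
  have hlen : ∀ e : FBondY i, (geo9K i).len (ιB (blkV1 i.hN i.D e)) = ((ℓ : ℝ) + 1) ^ ((blkV1 i.hN i.D e).1.1) * |i.cf|⁻¹ :=
    len_blkB_eqK i ιB hι
  have hlen0 : ∀ e : FBondY i, 0 < ((ℓ : ℝ) + 1) ^ ((blkV1 i.hN i.D e).1.1) * |i.cf|⁻¹ := fun e => by
    rw [← hlen e]; exact geo9K_len_pos i _
  revert hKe
  match n with
  | 0 =>
    intro hKe
    show (⨆ Λ : TestY 𝔸 J, wNormBY i (2 + γ) (O (cfg c) Λ.1)) ≤ C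
    refine iSup_testY_le (fun Λ => wNormBY_le_of_pointwise i hC fun e => ?_) hC
    have h1 : ‖O (cfg c) Λ.1 e‖ ≤ supInB i (blkV1 i.hN i.D e) (O (cfg c) Λ.1) := norm_le_supInB i _ _ rfl
    have h2 := hKe e Λ
    have hp : B9.pref4 ((geo9K i).len (ιB (blkV1 i.hN i.D e))) 0 = (geo9K i).len (ιB (blkV1 i.hN i.D e)) ^ 2 := rfl
    rw [hp, hlen e] at h2
    have hsplit : (((ℓ : ℝ) + 1) ^ ((blkV1 i.hN i.D e).1.1) * |i.cf|⁻¹) ^ (2 + γ) =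
        (((ℓ : ℝ) + 1) ^ ((blkV1 i.hN i.D e).1.1) * |i.cf|⁻¹) ^ 2 * (((ℓ : ℝ) + 1) ^ ((blkV1 i.hN i.D e).1.1) * |i.cf|⁻¹) ^ γ := by
      rw [Real.rpow_add (hlen0 e), Real.rpow_two]
    rw [hsplit, ← mul_assoc]
    exact h1.trans h2
  | 1 =>
    intro hKe
    show (⨆ Λ : TestY 𝔸 J, ⨆ ν : Fin (d + 1), wNormBY i (1 + γ) (cdB i (cfg c) ν (O (cfg c) Λ.1))) ≤ C
    refine iSup_testY_le (fun Λ => Real.iSup_le (fun ν => wNormBY_le_of_pointwise i hC fun e => ?_) hC) hC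
    have h1 : ‖cdB i (cfg c) ν (O (cfg c) Λ.1) e‖ ≤
        ⨆ ν' : Fin (d + 1), supInB i (blkV1 i.hN i.D e) (cdB i (cfg c) ν' (O (cfg c) Λ.1)) :=
      (norm_le_supInB i _ _ rfl).trans
        (le_iSup_fin (fun ν' => supInB i (blkV1 i.hN i.D e) (cdB i (cfg c) ν' (O (cfg c) Λ.1))) ν)
    have h2 := hKe e Λ
    have hp : B9.pref4 ((geo9K i).len (ιB (blkV1 i.hN i.D e))) 1 = (geo9K i).len (ιB (blkV1 i.hN i.D e)) := rfl
    rw [hp, hlen e] at h2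
    have hsplit : (((ℓ : ℝ) + 1) ^ ((blkV1 i.hN i.D e).1.1) * |i.cf|⁻¹) ^ (1 + γ) =
        (((ℓ : ℝ) + 1) ^ ((blkV1 i.hN i.D e).1.1) * |i.cf|⁻¹) * (((ℓ : ℝ) + 1) ^ ((blkV1 i.hN i.D e).1.1) * |i.cf|⁻¹) ^ γ := by
      rw [Real.rpow_add (hlen0 e), Real.rpow_one]
    rw [hsplit, ← mul_assoc]
    exact h1.trans h2
  | 2 =>
    intro hKe
    show (⨆ Λ : TestY 𝔸 J, ⨆ ν : Fin (d + 1), wNormBY i (1 + γ) (O (cfg c) (cdsB i (cfg c) ν Λ.1))) ≤ C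
    refine iSup_testY_le (fun Λ => Real.iSup_le (fun ν => wNormBY_le_of_pointwise i hC fun e => ?_) hC) hC
    have h1 : ‖O (cfg c) (cdsB i (cfg c) ν Λ.1) e‖ ≤
        ⨆ ν' : Fin (d + 1), supInB i (blkV1 i.hN i.D e) (O (cfg c) (cdsB i (cfg c) ν' Λ.1)) :=
      (norm_le_supInB i _ _ rfl).trans
        (le_iSup_fin (fun ν' => supInB i (blkV1 i.hN i.D e) (O (cfg c) (cdsB i (cfg c) ν' Λ.1))) ν)
    have h2 := hKe e Λ
    have hp : B9.pref4 ((geo9K i).len (ιB (blkV1 i.hN i.D e))) 2 = (geo9K i).len (ιB (blkV1 i.hN i.D e)) := rfl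
    rw [hp, hlen e] at h2
    have hsplit : (((ℓ : ℝ) + 1) ^ ((blkV1 i.hN i.D e).1.1) * |i.cf|⁻¹) ^ (1 + γ) =
        (((ℓ : ℝ) + 1) ^ ((blkV1 i.hN i.D e).1.1) * |i.cf|⁻¹) * (((ℓ : ℝ) + 1) ^ ((blkV1 i.hN i.D e).1.1) * |i.cf|⁻¹) ^ γ := by
      rw [Real.rpow_add (hlen0 e), Real.rpow_one]
    rw [hsplit, ← mul_assoc]
    exact h1.trans h2
  | 3 =>
    intro hKe
    show (⨆ Λ : TestY 𝔸 J, wNormBY i γ (lapB i (cfg c) (O (cfg c) Λ.1))) ≤ C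
    refine iSup_testY_le (fun Λ => wNormBY_le_of_pointwise i hC fun e => ?_) hC
    have h1 : ‖lapB i (cfg c) (O (cfg c) Λ.1) e‖ ≤ supInB i (blkV1 i.hN i.D e) (lapB i (cfg c) (O (cfg c) Λ.1)) := norm_le_supInB i _ _ rfl
    have h2 := hKe e Λ
    have hp : B9.pref4 ((geo9K i).len (ιB (blkV1 i.hN i.D e))) 3 = 1 := rfl
    rw [hp, hlen e, mul_one] at h2
    exact h1.trans h2

end GlobLe

/-! ## §4 ★★ The reading axioms and (3.47) from (3.42) for `kernelFamilyBInv` at a bare k-level index -/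

section Main

variable (i : KIdx d ℓ hd hL b₀ b₁) (ιB : BlkY i → IBondY i)

/-- ★★ **THE READING AXIOMS `GlobReading` HOLD FOR `kernelFamilyBInv` ON THE BOND ARGUMENTS**, block pieces `Δ(y′)·` by `Set.indicator`, at a bare k-level index with a
section `ιB` of `β`, every `B`, `cfg`, `O`, `par`, every configuration. [cite: Balaban1985BackgroundPropagators, (3.39)–(3.42) p.397, (3.47) p.398, Thm 3.3 p.399; Balaban1984PropagatorsII, (2.52) p.232] -/
theorem globReading_kernelFamilyBInv [Fintype (geo9K i).Site] (hι : ∀ s : BlkY i, β i.hN i.D i.hk (ιB s) = s)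
    (B : B9.Backgrounds) (cfg : B.Cfg → CfgY 𝔸 i) (O : BondOpY 𝔸 i) (par : BondParY 𝔸 i) (c : B.Cfg) :
    GlobReading (g := geo9K i) (kernelFamilyBInv i B cfg O par) (fun lam => ∃ J, lam = Sum.inr J) c
      (fun b lam => match lam with
        | .inl f => .inl f
        | .inr J => .inr (Set.indicator {e : FBondY i | ιB (blkV1 i.hN i.D e) = b} J)) where
  res_P := by
    rintro b lam ⟨J, rfl⟩
    exact ⟨Set.indicator {e : FBondY i | ιB (blkV1 i.hN i.D e) = b} J, rfl⟩
  res_supp := by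
    rintro b lam ⟨J, rfl⟩
    exact suppIn_piece i ιB hι b J
  res_norm := by
    rintro b lam γ ⟨J, rfl⟩
    exact supNorm_piece_le i ιB hι b J γ
  e_subadd := by
    rintro n lam y ⟨J, rfl⟩
    exact e_subadd_kernelFamilyBInv i ιB B cfg O par c n J y
  glob_le := by
    rintro n lam γ C ⟨J, rfl⟩ hC h
    exact glob_le_kernelFamilyBInv i ιB hι B cfg O par c n J γ C hC h

/-- ★★ **(3.47) FROM (3.42) FOR `kernelFamilyBInv` AT A BARE k-LEVEL INDEX** (`B9Ineq347Reading.globBlockOn_of_eBlock` at this reading): given [4] (2.60) at `α` and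
(2.61) at `1 − α` for the transported block geometry `toB6 (geo9K i) Rr Hp` and the size condition `4·log L ≤ α·δ₀·Rr·(L·M_h)` — displayed, exactly as in the
G-B9-LETTERS endpoints — the (3.42) block `EBlock (kernelFamilyBInv …) B₀ δ₀ c` gives the (3.47) block ON THE BOND ARGUMENTS with the one constant
`B₀·c₁(d′, δ₀, 1−α)·L⁴`. [cite: Balaban1985BackgroundPropagators, (3.42) p.397, (3.47) p.398 («consequences of the local ones (3.42) and Lemma 2.1»), Thm 3.3 p.399; Balaban1984PropagatorsII, Lemma 2.1 (2.60)–(2.61) p.234] -/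
theorem globBlockOn_kernelFamilyBInv_of_eBlock [Fintype (geo9K i).Site] (hι : ∀ s : BlkY i, β i.hN i.D i.hk (ιB s) = s)
    (B : B9.Backgrounds) (cfg : B.Cfg → CfgY 𝔸 i) (O : BondOpY 𝔸 i) (par : BondParY 𝔸 i) (c : B.Cfg)
    (d' : ℕ) {Rr : ℝ} {Hp : Prop} {δ₀ α B₀ : ℝ} (hB₀ : 0 ≤ B₀)
    (hsize : 4 * Real.log (geo9K i).L ≤ α * δ₀ * Rr * (geo9K i).M)
    (h260 : Ineq260 (toB6 (geo9K i) Rr Hp) δ₀ α) (h261 : Ineq261 d' (toB6 (geo9K i) Rr Hp) δ₀ (1 - α))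
    (hE : EBlock (kernelFamilyBInv i B cfg O par) B₀ δ₀ c) :
    GlobBlockOn (g := geo9K i) (kernelFamilyBInv i B cfg O par) (fun lam => ∃ J, lam = Sum.inr J)
      (B₀ * B6.c1 d' δ₀ (1 - α) * (geo9K i).L ^ (4 : ℝ)) c :=
  globBlockOn_of_eBlock (globReading_kernelFamilyBInv i ιB hι B cfg O par c) d' hB₀ (geo9K_one_le_L i) (geo9K_eta_pos i)
    (fun γ lam => geo9K_wNorm_nonneg i γ lam) hsize h260 h261 hE

end Main

/-! ## §5 ★★★ The three weighted Δ_a-side members of the [B8] Thm 2 torus binder, read off the (3.47) block -/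

section Weighted

variable (i : KIdx d ℓ hd hL b₀ b₁)

omit [NormedAlgebra ℂ 𝔸] [CompleteSpace 𝔸] [FiniteDimensional ℝ 𝔸] in
/-- the (3.41) norm of the profile `‖F‖` IS def-Y's weighted norm of `F`. [cite: Balaban1985BackgroundPropagators, (3.41) p.397, dictionary] -/
theorem wNormB_norm_eq_wNormBY (γ : ℝ) (F : FBondY i → 𝔸) : wNormB i γ (fun e => ‖F e‖) = wNormBY i γ F := by
  show msup (ℓ + 1) i.k |i.cf|⁻¹ γ (fun j (x : FBondY i) => (blkV1 i.hN i.D x).1.1 = j) (fun e => ‖F e‖) =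
    msup (ℓ + 1) i.k |i.cf|⁻¹ γ (fun j (x : FBondY i) => (blkV1 i.hN i.D x).1.1 = j) F
  unfold msup
  congr 1
  funext p
  rw [Real.norm_eq_abs, abs_norm]

omit [NormedAlgebra ℂ 𝔸] [CompleteSpace 𝔸] [FiniteDimensional ℝ 𝔸] in
/-- every `𝔸`-valued bond function is a class member of its own profile `‖F‖`. [cite: Balaban1985BackgroundPropagators, (3.39) p.397, bookkeeping] -/
theorem self_mem_testY (F : FBondY i → 𝔸) : ∀ e, ‖F e‖ ≤ |(fun e' => ‖F e'‖) e| := fun _ => le_abs_self _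

omit [CompleteSpace 𝔸] in
/-- a weighted norm of an ℝ-linear image is bounded uniformly over the class (finite lattice, finite dimension). [cite: Balaban1985BackgroundPropagators, (3.39) p.397, (3.41) p.397, bookkeeping] -/
theorem exists_testY_bound_wNormBY (T : (FBondY i → 𝔸) →ₗ[ℝ] (FBondY i → 𝔸)) (J : FBondY i → ℝ) (a : ℝ) :
    ∃ C : ℝ, ∀ Λ : TestY 𝔸 J, wNormBY i a (T Λ.1) ≤ C := by
  obtain ⟨C, hC, h⟩ := exists_testY_bound_lin i T J
  -- the largest weight over the finitely many levels `j ≤ k`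
  set W : ℝ := ∑ j ∈ Finset.range (i.k + 1), |weight (ℓ + 1) |i.cf|⁻¹ a j| with hW
  refine ⟨W * C, fun Λ => ?_⟩
  unfold wNormBY
  refine B8ScaledSupNorm.msup_le (mul_nonneg (Finset.sum_nonneg fun j _ => abs_nonneg _) hC) fun j hj e _ => ?_
  have hwj : weight (ℓ + 1) |i.cf|⁻¹ a j ≤ W :=
    (le_abs_self _).trans (Finset.single_le_sum (f := fun j => |weight (ℓ + 1) |i.cf|⁻¹ a j|) (fun j _ => abs_nonneg _)
      (Finset.mem_range.2 (Nat.lt_succ_of_le hj)))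
  have hw0 : 0 ≤ weight (ℓ + 1) |i.cf|⁻¹ a j := B8ScaledSupNorm.weight_nonneg (ℓ + 1) (inv_nonneg.2 (abs_nonneg _)) a j
  exact mul_le_mul hwj (h Λ e) (norm_nonneg _) (Finset.sum_nonneg fun j _ => abs_nonneg _)

/-- ★★★ **THE THREE WEIGHTED Δ_a-SIDE MEMBERS OF THE [B8] THM 2 TORUS BINDER FROM THE (3.47) BLOCK OF THE CLASS READING.**  If the (3.47) block
`GlobBlockOn (kernelFamilyBInv i B cfg O par) (bond args) B₀ c` holds, then at `U := cfg c`, for EVERY `𝔸`-valued bond function `F`: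
`|O(U)F|₍₋₁₎ ≤ B₀|F|₍₋₃₎`, `|∇_{U,ν}O(U)F|₍₋₂₎ ≤ B₀|F|₍₋₃₎` (every `ν`), `|Δ_U O(U)F|₍₋₃₎ ≤ B₀|F|₍₋₃₎` — the entries `n = 0, 1, 3` of (3.47) at `γ = −3` at the class
member `F` of the profile `‖F‖`; VERBATIM members (2)–(4) of `B9B8KnitTorusSocketCataloguedFour.sockB9P3Per_torus_allLevels_catalogued_four`'s binder at
`O := GAY i (parKnitY i) (parBY i) (GpY i (parKnitY i))`, `cfg c := bgY i U₀`.
[cite: Balaban1985BackgroundPropagators, (3.47) p.398, (3.39)–(3.41) p.397, Thm 3.3 p.399 («the same statements hold for the operators G(U)»), (3.69) p.404; Balaban1985RegularSpaces, Thm 2 p.83, (1.58)–(1.60) pp.86–87] -/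
theorem wNormBY_three_of_globBlockOn (B : B9.Backgrounds) (cfg : B.Cfg → CfgY 𝔸 i) (O : BondOpY 𝔸 i) (par : BondParY 𝔸 i) (c : B.Cfg) {B₀ : ℝ}
    (hG : GlobBlockOn (g := geo9K i) (kernelFamilyBInv i B cfg O par) (fun lam => ∃ J, lam = Sum.inr J) B₀ c) :
    (∀ F, wNormBY i (-1) (O (cfg c) F) ≤ B₀ * wNormBY i (-3) F) ∧
    (∀ F ν, wNormBY i (-2) (cdB i (cfg c) ν (O (cfg c) F)) ≤ B₀ * wNormBY i (-3) F) ∧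
    (∀ F, wNormBY i (-3) (lapB i (cfg c) (O (cfg c) F)) ≤ B₀ * wNormBY i (-3) F) := by
  have hw : ∀ F : FBondY i → 𝔸, (geo9K i).wNorm (-3) (.inr fun e => ‖F e‖) = wNormBY i (-3) F :=
    fun F => wNormB_norm_eq_wNormBY i (-3) F
  refine ⟨fun F => ?_, fun F ν => ?_, fun F => ?_⟩
  · have h := hG 0 (.inr fun e => ‖F e‖) (-3) ⟨_, rfl⟩ (by norm_num) (by norm_num)
    rw [hw F] at h
    have h0 : (kernelFamilyBInv i B cfg O par).glob 0 c (.inr fun e => ‖F e‖) (-3) =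
        ⨆ Λ : TestY 𝔸 (fun e => ‖F e‖), wNormBY i (2 + (-3)) (O (cfg c) Λ.1) := rfl
    rw [h0] at h
    have h1 : wNormBY i (-1) (O (cfg c) F) ≤ ⨆ Λ : TestY 𝔸 (fun e => ‖F e‖), wNormBY i (2 + (-3)) (O (cfg c) Λ.1) := by
      have := le_iSup_testY (exists_testY_bound_wNormBY i ((O (cfg c)).restrictScalars ℝ) (fun e => ‖F e‖) (2 + (-3))).choose_spec
        ⟨F, self_mem_testY i F⟩
      norm_num at this ⊢
      exact this
    exact h1.trans h
  · have h := hG 1 (.inr fun e => ‖F e‖) (-3) ⟨_, rfl⟩ (by norm_num) (by norm_num)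
    rw [hw F] at h
    have h0 : (kernelFamilyBInv i B cfg O par).glob 1 c (.inr fun e => ‖F e‖) (-3) =
        ⨆ Λ : TestY 𝔸 (fun e => ‖F e‖), ⨆ ν : Fin (d + 1), wNormBY i (1 + (-3)) (cdB i (cfg c) ν (O (cfg c) Λ.1)) := rfl
    rw [h0] at h
    have hb : ∀ ν', ∃ C : ℝ, ∀ Λ : TestY 𝔸 (fun e => ‖F e‖), wNormBY i (1 + (-3)) (cdB i (cfg c) ν' (O (cfg c) Λ.1)) ≤ C := fun ν' => by
      obtain ⟨C, hC⟩ := exists_testY_bound_wNormBY i (cdBₗ i (cfg c) ν' ∘ₗ (O (cfg c)).restrictScalars ℝ) (fun e => ‖F e‖) (1 + (-3))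
      exact ⟨C, fun Λ => by simpa [cdBₗ_apply] using hC Λ⟩
    choose C hC using hb
    have h1 : wNormBY i (-2) (cdB i (cfg c) ν (O (cfg c) F)) ≤
        ⨆ Λ : TestY 𝔸 (fun e => ‖F e‖), ⨆ ν' : Fin (d + 1), wNormBY i (1 + (-3)) (cdB i (cfg c) ν' (O (cfg c) Λ.1)) := by
      have hin : wNormBY i (1 + (-3)) (cdB i (cfg c) ν (O (cfg c) F)) ≤
          ⨆ ν' : Fin (d + 1), wNormBY i (1 + (-3)) (cdB i (cfg c) ν' (O (cfg c) (⟨F, self_mem_testY i F⟩ : TestY 𝔸 (fun e => ‖F e‖)).1)) :=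
        le_iSup_fin (fun ν' => wNormBY i (1 + (-3)) (cdB i (cfg c) ν' (O (cfg c) F))) ν
      have hout := le_iSup_testY (F := fun Λ : TestY 𝔸 (fun e => ‖F e‖) =>
          ⨆ ν' : Fin (d + 1), wNormBY i (1 + (-3)) (cdB i (cfg c) ν' (O (cfg c) Λ.1)))
        (C := ⨆ ν', C ν') (fun Λ => ciSup_mono (Set.finite_range _).bddAbove fun ν' => hC ν' Λ) ⟨F, self_mem_testY i F⟩
      have := hin.trans hout
      norm_num at this ⊢
      exact this
    exact h1.trans h
  · have h := hG 3 (.inr fun e => ‖F e‖) (-3) ⟨_, rfl⟩ (by norm_num) (by norm_num)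
    rw [hw F] at h
    have h0 : (kernelFamilyBInv i B cfg O par).glob 3 c (.inr fun e => ‖F e‖) (-3) =
        ⨆ Λ : TestY 𝔸 (fun e => ‖F e‖), wNormBY i (-3) (lapB i (cfg c) (O (cfg c) Λ.1)) := rfl
    rw [h0] at h
    have h1 : wNormBY i (-3) (lapB i (cfg c) (O (cfg c) F)) ≤ ⨆ Λ : TestY 𝔸 (fun e => ‖F e‖), wNormBY i (-3) (lapB i (cfg c) (O (cfg c) Λ.1)) := by
      have hb := exists_testY_bound_wNormBY i (lapBₗ i (cfg c) ∘ₗ (O (cfg c)).restrictScalars ℝ) (fun e => ‖F e‖) (-3)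
      obtain ⟨C, hC⟩ := hb
      exact le_iSup_testY (F := fun Λ : TestY 𝔸 (fun e => ‖F e‖) => wNormBY i (-3) (lapB i (cfg c) (O (cfg c) Λ.1)))
        (fun Λ => by simpa [lapBₗ_apply] using hC Λ) ⟨F, self_mem_testY i F⟩
    exact h1.trans h

/-- ★★★ **THE THREE WEIGHTED MEMBERS STRAIGHT FROM THE (3.42) BLOCK AND LEMMA 2.1** (§4 ∘ the previous theorem): at a bare k-level index with a section `ιB` of `β`,
[4] (2.60) at `α`, (2.61) at `1 − α` for `toB6 (geo9K i) Rr Hp`, the size condition `4·log L ≤ α·δ₀·Rr·(L·M_h)`, and the (3.42) block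
`EBlock (kernelFamilyBInv i B cfg O par) B₀ δ₀ c` give, with `B₀′ := B₀·c₁(d′, δ₀, 1−α)·L⁴` and `U := cfg c`: `∀ F, |O(U)F|₍₋₁₎ ≤ B₀′|F|₍₋₃₎`,
`∀ F ν, |∇_{U,ν}O(U)F|₍₋₂₎ ≤ B₀′|F|₍₋₃₎`, `∀ F, |Δ_U O(U)F|₍₋₃₎ ≤ B₀′|F|₍₋₃₎`.
[cite: Balaban1985BackgroundPropagators, (3.42) p.397, (3.47) p.398 («consequences of the local ones (3.42) and Lemma 2.1»), Thm 3.3 p.399, (3.69) p.404; Balaban1984PropagatorsII, Lemma 2.1 (2.60)–(2.61) p.234; Balaban1985RegularSpaces, Thm 2 p.83, (1.58)–(1.60) pp.86–87] -/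
theorem wNormBY_three_of_eBlock [Fintype (geo9K i).Site] (ιB : BlkY i → IBondY i) (hι : ∀ s : BlkY i, β i.hN i.D i.hk (ιB s) = s)
    (B : B9.Backgrounds) (cfg : B.Cfg → CfgY 𝔸 i) (O : BondOpY 𝔸 i) (par : BondParY 𝔸 i) (c : B.Cfg)
    (d' : ℕ) {Rr : ℝ} {Hp : Prop} {δ₀ α B₀ : ℝ} (hB₀ : 0 ≤ B₀)
    (hsize : 4 * Real.log (geo9K i).L ≤ α * δ₀ * Rr * (geo9K i).M)
    (h260 : Ineq260 (toB6 (geo9K i) Rr Hp) δ₀ α) (h261 : Ineq261 d' (toB6 (geo9K i) Rr Hp) δ₀ (1 - α))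
    (hE : EBlock (kernelFamilyBInv i B cfg O par) B₀ δ₀ c) :
    (∀ F, wNormBY i (-1) (O (cfg c) F) ≤ (B₀ * B6.c1 d' δ₀ (1 - α) * (geo9K i).L ^ (4 : ℝ)) * wNormBY i (-3) F) ∧
    (∀ F ν, wNormBY i (-2) (cdB i (cfg c) ν (O (cfg c) F)) ≤ (B₀ * B6.c1 d' δ₀ (1 - α) * (geo9K i).L ^ (4 : ℝ)) * wNormBY i (-3) F) ∧
    (∀ F, wNormBY i (-3) (lapB i (cfg c) (O (cfg c) F)) ≤ (B₀ * B6.c1 d' δ₀ (1 - α) * (geo9K i).L ^ (4 : ℝ)) * wNormBY i (-3) F) :=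
  wNormBY_three_of_globBlockOn i B cfg O par c (globBlockOn_kernelFamilyBInv_of_eBlock i ιB hι B cfg O par c d' hB₀ hsize h260 h261 hE)

end Weighted

end Literature.MathematicalPhysics.QuantumFieldTheory.Balaban1983to89.B9Ineq347BondReadingYInv

end
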